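import Summits.CriticalPhenomena.PercolationContinuityZ3.Theorems.PercNearOneGluingNoHeavyLowerTailSahiOneStepTwoChainGrid
import HarnessLib

/-!
# The two-chain collapse theorem with a FUZZY first slot (layer-cake over grid up-sets)

Support file (prover prim-ineq-prove-3 gen 24; `--supports stmt-CriticalPhenomena-4575`; memo
`run/shared/lean/prim/prim-ineq-prove-3/FINDING-G24-TWO-CHAIN.md` §0(iii), §1).  No definitions, no sorries.

`grid_collapse_fuzzy`: the grid inequality of `…TwoChainGrid.grid_collapse_upset` with the indicator of the first up-set replaced by an
arbitrary `[0,1]`-valued function `α` on the grid that is nondecreasing in both coordinates (a "fuzzy up-set"; in the cube application,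
`α(k,j) = μ(U ∣ N_T = k, N_R = j)` for an increasing event `U`).  Proof: the functional is linear in `α`, and `α` is peeled into grid
up-sets by the layer-cake recursion `α = τ·1[τ ≤ α] + (α − τ)₊` (`τ` = least positive value of `α` on the grid), each layer being an
instance of `grid_collapse_upset`; induction on the number of grid cells where `α > 0`.
-/

namespace Summit.CriticalPhenomena.PercolationContinuityZ3.Theorems

namespace SahiOneStep

namespace TwoChain

open Finset

/-- **TWO-CHAIN COLLAPSE, fuzzy first slot** (memo §1): for product probability weights `a ⊗ b` on `{0..K}×{0..J}`, `H = {t ≤ k+j}`,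
`L = Hᶜ`, a grid up-set `B = {PB}` and a `[0,1]`-valued `α` nondecreasing in both coordinates,
`(Σ_L abα)(Σ_{L∩B} ab) + (Σ_L ab)(Σ_{H∩B} abα) − (Σ_L ab)(Σ abα)(Σ_B ab) ≥ 0`. [this work] -/
theorem grid_collapse_fuzzy (K J t : ℕ) (a b : ℕ → ℝ) (α : ℕ → ℕ → ℝ) (PB : ℕ → ℕ → Prop) [∀ k j, Decidable (PB k j)]
    (ha : ∀ k, 0 ≤ a k) (hb : ∀ j, 0 ≤ b j) (hA1 : ∑ k ∈ range (K + 1), a k = 1) (hB1 : ∑ j ∈ range (J + 1), b j = 1)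
    (hα0 : ∀ k j, 0 ≤ α k j) (hα1 : ∀ k j, α k j ≤ 1)
    (hαk : ∀ k k' j, k ≤ k' → α k j ≤ α k' j) (hαj : ∀ k j j', j ≤ j' → α k j ≤ α k j')
    (hPBk : ∀ k k' j, k ≤ k' → PB k j → PB k' j) (hPBj : ∀ k j j', j ≤ j' → PB k j → PB k j') :
    0 ≤ (∑ k ∈ range (K + 1), ∑ j ∈ range (J + 1), if k + j < t then a k * b j * α k j else 0) *
          (∑ k ∈ range (K + 1), ∑ j ∈ range (J + 1), if k + j < t ∧ PB k j then a k * b j else 0)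
        + (∑ k ∈ range (K + 1), ∑ j ∈ range (J + 1), if k + j < t then a k * b j else 0) *
          (∑ k ∈ range (K + 1), ∑ j ∈ range (J + 1), if t ≤ k + j ∧ PB k j then a k * b j * α k j else 0)
        - (∑ k ∈ range (K + 1), ∑ j ∈ range (J + 1), if k + j < t then a k * b j else 0) *
          (∑ k ∈ range (K + 1), ∑ j ∈ range (J + 1), a k * b j * α k j) *
          (∑ k ∈ range (K + 1), ∑ j ∈ range (J + 1), if PB k j then a k * b j else 0) := by
  set SK := range (K + 1) with hSK
  set SJ := range (J + 1) with hSJ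
  set G := SK ×ˢ SJ with hG
  -- the three constants of the (linear in `α`) functional
  set SBL := ∑ k ∈ SK, ∑ j ∈ SJ, if k + j < t ∧ PB k j then a k * b j else 0 with hSBL
  set SL := ∑ k ∈ SK, ∑ j ∈ SJ, if k + j < t then a k * b j else 0 with hSL
  set SB := ∑ k ∈ SK, ∑ j ∈ SJ, if PB k j then a k * b j else 0 with hSB
  -- induction on the number of grid cells where the fuzzy up-set is positive
  suffices main : ∀ n : ℕ, ∀ β : ℕ → ℕ → ℝ, (∀ k j, 0 ≤ β k j) → (∀ k j, β k j ≤ 1) →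
      (∀ k k' j, k ≤ k' → β k j ≤ β k' j) → (∀ k j j', j ≤ j' → β k j ≤ β k j') →
      (G.filter (fun c => 0 < β c.1 c.2)).card ≤ n →
      0 ≤ (∑ k ∈ SK, ∑ j ∈ SJ, if k + j < t then a k * b j * β k j else 0) * SBL
          + SL * (∑ k ∈ SK, ∑ j ∈ SJ, if t ≤ k + j ∧ PB k j then a k * b j * β k j else 0)
          - SL * (∑ k ∈ SK, ∑ j ∈ SJ, a k * b j * β k j) * SB by
    exact main _ α hα0 hα1 hαk hαj le_rfl
  intro n
  induction n with
  | zero =>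
    intro β hβ0 hβ1 hβk hβj hcard
    -- no positive cell: all `β`-sums vanish
    have hzero : ∀ k ∈ SK, ∀ j ∈ SJ, β k j = 0 := by
      intro k hk j hj
      by_contra hne
      have hpos : 0 < β k j := lt_of_le_of_ne (hβ0 k j) (Ne.symm hne)
      have hmem : (k, j) ∈ G.filter (fun c => 0 < β c.1 c.2) :=
        Finset.mem_filter.2 ⟨Finset.mem_product.2 ⟨hk, hj⟩, hpos⟩
      have : 0 < (G.filter (fun c => 0 < β c.1 c.2)).card := Finset.card_pos.2 ⟨_, hmem⟩
      omega
    have s1 : (∑ k ∈ SK, ∑ j ∈ SJ, if k + j < t then a k * b j * β k j else 0) = 0 :=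
      Finset.sum_eq_zero fun k hk => Finset.sum_eq_zero fun j hj => by rw [hzero k hk j hj]; simp
    have s2 : (∑ k ∈ SK, ∑ j ∈ SJ, if t ≤ k + j ∧ PB k j then a k * b j * β k j else 0) = 0 :=
      Finset.sum_eq_zero fun k hk => Finset.sum_eq_zero fun j hj => by rw [hzero k hk j hj]; simp
    have s3 : (∑ k ∈ SK, ∑ j ∈ SJ, a k * b j * β k j) = 0 :=
      Finset.sum_eq_zero fun k hk => Finset.sum_eq_zero fun j hj => by rw [hzero k hk j hj]; simp
    rw [s1, s2, s3]; simp
  | succ n ih =>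
    intro β hβ0 hβ1 hβk hβj hcard
    set D := G.filter (fun c => 0 < β c.1 c.2) with hD
    by_cases hDe : D = ∅
    · -- again all sums vanish
      have hzero : ∀ k ∈ SK, ∀ j ∈ SJ, β k j = 0 := by
        intro k hk j hj
        by_contra hne
        have hpos : 0 < β k j := lt_of_le_of_ne (hβ0 k j) (Ne.symm hne)
        have hmem : (k, j) ∈ D := Finset.mem_filter.2 ⟨Finset.mem_product.2 ⟨hk, hj⟩, hpos⟩
        rw [hDe] at hmem
        exact Finset.notMem_empty _ hmem
      have s1 : (∑ k ∈ SK, ∑ j ∈ SJ, if k + j < t then a k * b j * β k j else 0) = 0 :=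
        Finset.sum_eq_zero fun k hk => Finset.sum_eq_zero fun j hj => by rw [hzero k hk j hj]; simp
      have s2 : (∑ k ∈ SK, ∑ j ∈ SJ, if t ≤ k + j ∧ PB k j then a k * b j * β k j else 0) = 0 :=
        Finset.sum_eq_zero fun k hk => Finset.sum_eq_zero fun j hj => by rw [hzero k hk j hj]; simp
      have s3 : (∑ k ∈ SK, ∑ j ∈ SJ, a k * b j * β k j) = 0 :=
        Finset.sum_eq_zero fun k hk => Finset.sum_eq_zero fun j hj => by rw [hzero k hk j hj]; simp
      rw [s1, s2, s3]; simp
    · have hDne : D.Nonempty := Finset.nonempty_iff_ne_empty.2 hDe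
      -- least positive value `τ`
      set vals := D.image (fun c => β c.1 c.2) with hvals
      have hvne : vals.Nonempty := hDne.image _
      set τ := vals.min' hvne with hτ
      have hτmem : τ ∈ vals := Finset.min'_mem _ _
      obtain ⟨c0, hc0D, hc0τ⟩ := Finset.mem_image.1 hτmem
      have hτpos : 0 < τ := by rw [← hc0τ]; exact (Finset.mem_filter.1 hc0D).2
      have hτle : ∀ c ∈ D, τ ≤ β c.1 c.2 := fun c hc => Finset.min'_le _ _ (Finset.mem_image_of_mem _ hc)
      -- on grid cells `β ∈ {0} ∪ [τ, 1]`
      have hcell : ∀ k ∈ SK, ∀ j ∈ SJ, β k j = 0 ∨ τ ≤ β k j := by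
        intro k hk j hj
        by_cases hpos : 0 < β k j
        · exact Or.inr (hτle (k, j) (Finset.mem_filter.2 ⟨Finset.mem_product.2 ⟨hk, hj⟩, hpos⟩))
        · exact Or.inl (le_antisymm (not_lt.1 hpos) (hβ0 k j))
      -- the peeled function and the layer
      set β' : ℕ → ℕ → ℝ := fun k j => max (β k j - τ) 0 with hβ'
      have hβ'0 : ∀ k j, 0 ≤ β' k j := fun k j => le_max_right _ _
      have hβ'1 : ∀ k j, β' k j ≤ 1 := fun k j => max_le (by linarith [hβ1 k j]) zero_le_one
      have hβ'k : ∀ k k' j, k ≤ k' → β' k j ≤ β' k' j := fun k k' j hkk' =>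
        max_le_max (sub_le_sub_right (hβk k k' j hkk') τ) le_rfl
      have hβ'j : ∀ k j j', j ≤ j' → β' k j ≤ β' k j' := fun k j j' hjj' =>
        max_le_max (sub_le_sub_right (hβj k j j' hjj') τ) le_rfl
      -- values of `β'` on grid cells
      have hβ'zero : ∀ k ∈ SK, ∀ j ∈ SJ, β k j = 0 → β' k j = 0 := by
        intro k _ j _ h0
        simp only [hβ']; rw [h0]; exact max_eq_right (by linarith)
      have hβ'sub : ∀ k j, τ ≤ β k j → β' k j = β k j - τ := by
        intro k j hge
        simp only [hβ']; exact max_eq_left (sub_nonneg.2 hge)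
      -- fewer positive cells for `β'`
      have hcard' : (G.filter (fun c => 0 < β' c.1 c.2)).card ≤ n := by
        have hsub : G.filter (fun c => 0 < β' c.1 c.2) ⊆ D.erase c0 := by
          intro c hc
          rw [Finset.mem_filter] at hc
          rw [Finset.mem_erase]
          have hpos' : 0 < β' c.1 c.2 := hc.2
          have hgt : τ < β c.1 c.2 := by
            by_contra hle
            have : β' c.1 c.2 = 0 := by simp only [hβ']; exact max_eq_right (by linarith [not_lt.1 hle])
            linarith
          refine ⟨fun hcc0 => ?_, Finset.mem_filter.2 ⟨hc.1, lt_trans hτpos hgt⟩⟩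
          rw [hcc0] at hgt; linarith
        calc (G.filter (fun c => 0 < β' c.1 c.2)).card ≤ (D.erase c0).card := Finset.card_le_card hsub
          _ = D.card - 1 := Finset.card_erase_of_mem hc0D
          _ ≤ n := by omega
      have hrec := ih β' hβ'0 hβ'1 hβ'k hβ'j hcard'
      -- the layer `{τ ≤ β}` is a grid up-set
      have hlayer := grid_collapse_upset K J t a b (fun k j => τ ≤ β k j) PB ha hb hA1 hB1
        (fun k k' j hkk' h => le_trans h (hβk k k' j hkk')) (fun k j j' hjj' h => le_trans h (hβj k j j' hjj')) hPBk hPBj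
      -- split the three `β`-sums
      have e1 : (∑ k ∈ SK, ∑ j ∈ SJ, if k + j < t then a k * b j * β k j else 0)
          = τ * (∑ k ∈ SK, ∑ j ∈ SJ, if k + j < t ∧ τ ≤ β k j then a k * b j else 0)
            + ∑ k ∈ SK, ∑ j ∈ SJ, if k + j < t then a k * b j * β' k j else 0 := by
        rw [Finset.mul_sum, ← Finset.sum_add_distrib]
        refine Finset.sum_congr rfl fun k hk => ?_
        rw [Finset.mul_sum, ← Finset.sum_add_distrib]
        refine Finset.sum_congr rfl fun j hj => ?_
        rcases hcell k hk j hj with h0 | hge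
        · rw [hβ'zero k hk j hj h0, h0, if_neg (show ¬ (k + j < t ∧ τ ≤ (0:ℝ)) from fun h => (not_le.2 hτpos) h.2)]
          simp
        · rw [hβ'sub k j hge]
          by_cases hc : k + j < t
          · rw [if_pos hc, if_pos ⟨hc, hge⟩, if_pos hc]; ring
          · rw [if_neg hc, if_neg (fun h => hc h.1), if_neg hc]; ring
      have e2 : (∑ k ∈ SK, ∑ j ∈ SJ, if t ≤ k + j ∧ PB k j then a k * b j * β k j else 0)
          = τ * (∑ k ∈ SK, ∑ j ∈ SJ, if t ≤ k + j ∧ ((τ ≤ β k j) ∧ PB k j) then a k * b j else 0)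
            + ∑ k ∈ SK, ∑ j ∈ SJ, if t ≤ k + j ∧ PB k j then a k * b j * β' k j else 0 := by
        rw [Finset.mul_sum, ← Finset.sum_add_distrib]
        refine Finset.sum_congr rfl fun k hk => ?_
        rw [Finset.mul_sum, ← Finset.sum_add_distrib]
        refine Finset.sum_congr rfl fun j hj => ?_
        rcases hcell k hk j hj with h0 | hge
        · rw [hβ'zero k hk j hj h0, h0, if_neg (show ¬ (t ≤ k + j ∧ (τ ≤ (0:ℝ) ∧ PB k j)) from fun h => (not_le.2 hτpos) h.2.1)]
          simp
        · rw [hβ'sub k j hge]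
          by_cases hc : t ≤ k + j ∧ PB k j
          · rw [if_pos hc, if_pos ⟨hc.1, hge, hc.2⟩, if_pos hc]; ring
          · rw [if_neg hc, if_neg (fun h => hc ⟨h.1, h.2.2⟩), if_neg hc]; ring
      have e3 : (∑ k ∈ SK, ∑ j ∈ SJ, a k * b j * β k j)
          = τ * (∑ k ∈ SK, ∑ j ∈ SJ, if τ ≤ β k j then a k * b j else 0)
            + ∑ k ∈ SK, ∑ j ∈ SJ, a k * b j * β' k j := by
        rw [Finset.mul_sum, ← Finset.sum_add_distrib]
        refine Finset.sum_congr rfl fun k hk => ?_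
        rw [Finset.mul_sum, ← Finset.sum_add_distrib]
        refine Finset.sum_congr rfl fun j hj => ?_
        rcases hcell k hk j hj with h0 | hge
        · rw [hβ'zero k hk j hj h0, h0, if_neg (not_le.2 hτpos)]; ring
        · rw [hβ'sub k j hge, if_pos hge]; ring
      rw [e1, e2, e3]
      nlinarith [mul_nonneg hτpos.le hlayer, hrec]

/-- Density monotonicity along a two-step path: if cells `(k',j') ≤ (k,j)` both have positive weight then, under the cross-multiplied
row/column monotonicity `F1`, `F2`, the density at `(k',j')` is at most the density at `(k,j)`. [this work] -/
theorem density_mono_of_cross (a b : ℕ → ℝ) (u : ℕ → ℕ → ℝ) (ha : ∀ k, 0 ≤ a k) (hb : ∀ j, 0 ≤ b j)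
    (F1 : ∀ k k' j, k ≤ k' → u k j * a k' ≤ u k' j * a k) (F2 : ∀ k j j', j ≤ j' → u k j * b j' ≤ u k j' * b j)
    {k k' j j' : ℕ} (hkk' : k' ≤ k) (hjj' : j' ≤ j) (hpos' : 0 < a k' * b j') (hpos : 0 < a k * b j) :
    u k' j' / (a k' * b j') ≤ u k j / (a k * b j) := by
  have hak' : 0 < a k' := lt_of_le_of_ne (ha k') (fun h => by rw [← h, zero_mul] at hpos'; exact lt_irrefl 0 hpos')
  have hbj' : 0 < b j' := lt_of_le_of_ne (hb j') (fun h => by rw [← h, mul_zero] at hpos'; exact lt_irrefl 0 hpos')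
  have hak : 0 < a k := lt_of_le_of_ne (ha k) (fun h => by rw [← h, zero_mul] at hpos; exact lt_irrefl 0 hpos)
  have hbj : 0 < b j := lt_of_le_of_ne (hb j) (fun h => by rw [← h, mul_zero] at hpos; exact lt_irrefl 0 hpos)
  -- step 1: (k',j') → (k,j')
  have s1 : u k' j' / (a k' * b j') ≤ u k j' / (a k * b j') := by
    rw [div_le_div_iff₀ (mul_pos hak' hbj') (mul_pos hak hbj')]
    have := F1 k' k j' hkk'
    nlinarith [hbj', mul_le_mul_of_nonneg_right this hbj'.le]
  -- step 2: (k,j') → (k,j)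
  have s2 : u k j' / (a k * b j') ≤ u k j / (a k * b j) := by
    rw [div_le_div_iff₀ (mul_pos hak hbj') (mul_pos hak hbj)]
    have := F2 k j' j hjj'
    nlinarith [hak, mul_le_mul_of_nonneg_right this hak.le]
  exact s1.trans s2

/-- **TWO-CHAIN COLLAPSE in cell form** (the shape of `…SubblockGrid.grid_osN_nonneg`, with the sub-block threshold `{r ≤ k}` replaced by
an arbitrary grid up-set `B = {PB}`): sub-probability cell masses `u k j ≤ a k · b j` with cross-multiplied row/column monotonicity.
Proof: the up-closed density `α̃(k,j) = max{u/ab over positive cells below (k,j)}` is a fuzzy up-set agreeing with `u/ab` on positive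
cells; apply `grid_collapse_fuzzy`. [this work] -/
theorem grid_collapse_cells (K J t : ℕ) (a b : ℕ → ℝ) (u : ℕ → ℕ → ℝ) (PB : ℕ → ℕ → Prop) [∀ k j, Decidable (PB k j)]
    (ha : ∀ k, 0 ≤ a k) (hb : ∀ j, 0 ≤ b j) (hu : ∀ k j, 0 ≤ u k j) (hub : ∀ k j, u k j ≤ a k * b j)
    (F1 : ∀ k k' j, k ≤ k' → u k j * a k' ≤ u k' j * a k) (F2 : ∀ k j j', j ≤ j' → u k j * b j' ≤ u k j' * b j)
    (hA1 : ∑ k ∈ range (K + 1), a k = 1) (hB1 : ∑ j ∈ range (J + 1), b j = 1)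
    (hPBk : ∀ k k' j, k ≤ k' → PB k j → PB k' j) (hPBj : ∀ k j j', j ≤ j' → PB k j → PB k j') :
    0 ≤ (∑ k ∈ range (K + 1), ∑ j ∈ range (J + 1), if k + j < t then u k j else 0) *
          (∑ k ∈ range (K + 1), ∑ j ∈ range (J + 1), if k + j < t ∧ PB k j then a k * b j else 0)
        + (∑ k ∈ range (K + 1), ∑ j ∈ range (J + 1), if k + j < t then a k * b j else 0) *
          (∑ k ∈ range (K + 1), ∑ j ∈ range (J + 1), if t ≤ k + j ∧ PB k j then u k j else 0)
        - (∑ k ∈ range (K + 1), ∑ j ∈ range (J + 1), if k + j < t then a k * b j else 0) *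
          (∑ k ∈ range (K + 1), ∑ j ∈ range (J + 1), u k j) *
          (∑ k ∈ range (K + 1), ∑ j ∈ range (J + 1), if PB k j then a k * b j else 0) := by
  -- the up-closed density
  set dens : ℕ × ℕ → ℝ := fun c => u c.1 c.2 / (a c.1 * b c.2) with hdens
  set below : ℕ → ℕ → Finset (ℕ × ℕ) := fun k j =>
    ((range (k + 1)) ×ˢ (range (j + 1))).filter (fun c => 0 < a c.1 * b c.2) with hbelow
  set α : ℕ → ℕ → ℝ := fun k j => (insert (0:ℝ) ((below k j).image dens)).max' (Finset.insert_nonempty _ _) with hα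
  have dens_nonneg : ∀ c, 0 ≤ dens c := fun c => div_nonneg (hu c.1 c.2) (mul_nonneg (ha c.1) (hb c.2))
  have dens_le_one : ∀ c, dens c ≤ 1 := by
    intro c
    simp only [hdens]
    by_cases h : 0 < a c.1 * b c.2
    · rw [div_le_one h]; exact hub c.1 c.2
    · have h0 : a c.1 * b c.2 = 0 := le_antisymm (not_lt.1 h) (mul_nonneg (ha c.1) (hb c.2))
      rw [h0, div_zero]; exact zero_le_one
  have hα0 : ∀ k j, 0 ≤ α k j := fun k j => Finset.le_max' _ _ (Finset.mem_insert_self _ _)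
  have hα1 : ∀ k j, α k j ≤ 1 := by
    intro k j
    refine Finset.max'_le _ _ _ fun x hx => ?_
    rcases Finset.mem_insert.1 hx with rfl | hx
    · exact zero_le_one
    · obtain ⟨c, _, rfl⟩ := Finset.mem_image.1 hx; exact dens_le_one c
  have below_mono : ∀ k k' j j', k ≤ k' → j ≤ j' → below k j ⊆ below k' j' := by
    intro k k' j j' hkk' hjj' c hc
    simp only [hbelow, Finset.mem_filter, Finset.mem_product, Finset.mem_range] at hc ⊢
    exact ⟨⟨by omega, by omega⟩, hc.2⟩
  have hαmono : ∀ k k' j j', k ≤ k' → j ≤ j' → α k j ≤ α k' j' := by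
    intro k k' j j' hkk' hjj'
    exact Finset.max'_subset _ (Finset.insert_subset_insert _ (Finset.image_subset_image (below_mono k k' j j' hkk' hjj')))
  have hαk : ∀ k k' j, k ≤ k' → α k j ≤ α k' j := fun k k' j h => hαmono k k' j j h le_rfl
  have hαj : ∀ k j j', j ≤ j' → α k j ≤ α k j' := fun k j j' h => hαmono k k j j' le_rfl h
  -- agreement with `u` after multiplying by the cell weight
  have hagree : ∀ k j, a k * b j * α k j = u k j := by
    intro k j
    by_cases hpos : 0 < a k * b j
    · have hαeq : α k j = dens (k, j) := by
        apply le_antisymm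
        · refine Finset.max'_le _ _ _ fun x hx => ?_
          rcases Finset.mem_insert.1 hx with rfl | hx
          · exact dens_nonneg (k, j)
          · obtain ⟨c, hc, rfl⟩ := Finset.mem_image.1 hx
            simp only [hbelow, Finset.mem_filter, Finset.mem_product, Finset.mem_range] at hc
            exact density_mono_of_cross a b u ha hb F1 F2 (Nat.le_of_lt_succ hc.1.1) (Nat.le_of_lt_succ hc.1.2) hc.2 hpos
        · refine Finset.le_max' _ _ (Finset.mem_insert_of_mem (Finset.mem_image_of_mem _ ?_))
          simp only [hbelow, Finset.mem_filter, Finset.mem_product, Finset.mem_range]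
          exact ⟨⟨Nat.lt_succ_self k, Nat.lt_succ_self j⟩, hpos⟩
      rw [hαeq]; simp only [hdens]; rw [mul_comm]; exact div_mul_cancel₀ _ (ne_of_gt hpos)
    · have h0 : a k * b j = 0 := le_antisymm (not_lt.1 hpos) (mul_nonneg (ha k) (hb j))
      have hu0 : u k j = 0 := le_antisymm (by rw [← h0]; exact hub k j) (hu k j)
      rw [h0, hu0, zero_mul]
  have main := grid_collapse_fuzzy K J t a b α PB ha hb hA1 hB1 hα0 hα1 hαk hαj hPBk hPBj
  have r1 : (∑ k ∈ range (K + 1), ∑ j ∈ range (J + 1), if k + j < t then a k * b j * α k j else 0)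
      = ∑ k ∈ range (K + 1), ∑ j ∈ range (J + 1), if k + j < t then u k j else 0 :=
    Finset.sum_congr rfl fun k _ => Finset.sum_congr rfl fun j _ => by rw [hagree k j]
  have r2 : (∑ k ∈ range (K + 1), ∑ j ∈ range (J + 1), if t ≤ k + j ∧ PB k j then a k * b j * α k j else 0)
      = ∑ k ∈ range (K + 1), ∑ j ∈ range (J + 1), if t ≤ k + j ∧ PB k j then u k j else 0 :=
    Finset.sum_congr rfl fun k _ => Finset.sum_congr rfl fun j _ => by rw [hagree k j]
  have r3 : (∑ k ∈ range (K + 1), ∑ j ∈ range (J + 1), a k * b j * α k j)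
      = ∑ k ∈ range (K + 1), ∑ j ∈ range (J + 1), u k j :=
    Finset.sum_congr rfl fun k _ => Finset.sum_congr rfl fun j _ => hagree k j
  rw [r1, r2, r3] at main
  exact main

end TwoChain

end SahiOneStep

end Summit.CriticalPhenomena.PercolationContinuityZ3.Theorems
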